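import Literature.MathematicalPhysics.QuantumFieldTheory.Balaban1983to89.B11SectFReg165Assembly

/-!
# `Balaban1983to89.B11SectFReg165AssemblyWitness` — [Balaban1985Variational] Sect. F pp. 300–304: NON-VACUITY of the hypothesis structures
# `B11SectFReg165Assembly.ChainLeaves` / `UnitLeaves` (the located displays behind the leaves (165) on □ and on Δ₀(□)) — the FLAT STRATUM
# A ≡ 0 on a one-cube carrier inhabits both, jointly with the three remaining leaves of `B11SectFAssembly.Leaves`

statement-level skeleton of published theorems with citation tags; proofs where landed; nothing here is a claim about the Yang–Mills mass gap

WHY THIS FILE.  `B11SectFReg165Assembly.reg165_of_chain` / `reg165_unit_of_chain` / `leaves_of_chain_unit` derive the two (165)-leaves of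
`B11SectFAssembly.Leaves` from some thirty located hypotheses (`ChainLeaves`: (152)–(153), (157), (158), (46)/(117), (55), (98), (161)₁, (160),
(155), (144)/(148), (162)–(163), side conditions; `UnitLeaves`: the Δ₀(□) twins).  A referee's vacuity audit (pub-ymgap R417 act (iv)) asks
whether these binders can hold AT ALL together.  THIS FILE answers it at the FLAT STRATUM of [Balaban1985Variational] (2) p. 278 (U ≡ 1 lies in
𝔘_k(ε₀) for every ε₀ > 0; its Landau-gauge field is A ≡ 0, so A′ = A₁ = HB = 0, B = 0): §1 a one-cube Theorem-1 carrier `flatP` (one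
configuration, one boundary datum, one class cube of size M = R₁M₁ = 1; `InU ε U := 0 < ε`, `Gauged := True`, the norm functionals 0), a
one-site geometry `flatGeo` ([3] Sect. 2 read at k = 0: one multiscale point, d(·,·) = 0, L = 2, η = 1), the data `flatX` (E = F = ℝ, all
fields and operators 0, the □-seminorms = |·|, ℭ_k = {pt} = near part, far part ∅, |B| = 0), `flatD`/`flatY` (the Δ₀ data, all 0 / |·|);
§2 **`flat_chainLeaves`** — `ChainLeaves flatP flatX 0 (1/1152) 1 (1/2) 0 0 1 1 c₁ a₃ a₄` for ALL c₁, a₃, a₄ (δ₀ = 0, B₀ = 1/1152, B₁ = 1,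
B₃ = 72d³L³B₀S = ½ with S = 1 = the inner sum of (162) at the one point, so that (163) reads ½ ≦ ½; C₂ = C₄ = 0), **`flat_unitLeaves`**,
and **`flat_leaves`** — the full `B11SectFAssembly.Leaves` record at the flat stratum obtained THROUGH `leaves_of_chain_unit` (the remaining
leaves `dev1142`, `inU_local`, `holder136` being immediate there), i.e. the typed chain behind Theorem 1's Sect. F input is exercised end to
end on an inhabitant.

HONEST SCOPE.  A degenerate consistency witness (A ≡ 0, one cube, one site): it certifies that the hypothesis structures are jointly
satisfiable and that the assembled `Leaves` record is not an ex-falso artefact — nothing about genuine lattice objects (those are NODE 00's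
B11 pin), no estimate of the series.  Kernel bookkeeping; count-neutral (pub-ymgap Track A, node N07, seat dag-n07-c, strategy s1;
`--supports stmt-QuantumFields-19674`).  Imports `B11SectFReg165Assembly` ONLY; modifies nothing.
-/

noncomputable section

namespace Literature.MathematicalPhysics.QuantumFieldTheory.Balaban1983to89.B11SectFReg165AssemblyWitness

open Literature.MathematicalPhysics.QuantumFieldTheory.Balaban1983to89
open B11 B11SectFAssembly B11Eq161HBChain B11B3 B11Holder9 B11SectFReg165Assembly

/-! ## §1 The flat one-cube carrier and its data -/

/-- **The flat one-cube Theorem-1 carrier**: one configuration (U ≡ 1), one boundary datum, one class cube □ of size M = 1 at scale 0 with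
η = 1, L = 2; `InU ε U := 0 < ε` ((2): U ≡ 1 has |U(∂p) − 1| = 0 = |D*∂U| and lies in 𝔘_k(ε) iff ε > 0), `InB := True`, `Reg7 ε V := 0 < ε`,
`IsCritical := True` (U ≡ 1 is the absolute minimum of (5)), `Gauged := True` with the Landau-gauge field A ≡ 0: all norm functionals 0.
[cite: Balaban1985Variational, (2)–(6) p.278] -/
@[reducible] def flatP : B11.VarProblemX where
  Cfg := Unit
  Bdry := Unit
  Cube := Unit
  scale := fun _ => 0
  sizeM := fun _ => 1
  eta := 1
  L := 2
  InU := fun e _ => 0 < e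
  InB := fun _ _ => True
  Reg7 := fun e _ => 0 < e
  OnMinimalOrbit := fun e _ _ => 0 < e
  UniqueCriticalOrbit := fun e _ _ => 0 < e
  Gauged := fun _ _ => True
  normA := fun _ _ => 0
  normGradA := fun _ _ => 0
  holderA := fun _ _ _ => 0
  normLapA := fun _ _ => 0
  IsCritical := fun _ _ => True
  SameOrbit := fun _ _ => True

/-- **The one-site multiscale geometry** ([3] Sect. 2 at k = 0): one point, d(·,·) = 0, L = 2, η = 1 (so L^{j}η = 1), the function-space
fields trivial. [cite: Balaban1984PropagatorsII, (2.1)–(2.2) p.224, (2.46) p.231] -/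
@[reducible] def flatGeo : B6.Geometry where
  Site := Unit
  fin := inferInstance
  scale := fun _ => 0
  dist := fun _ _ => 0
  k := 0
  eta := 1
  L := 2
  R := 1
  M := 1
  Hyp21_22 := True
  Loc := Unit
  suppIn := fun _ _ => True
  supNorm := fun _ => 0
  l2Norm := fun _ => 0
  holder := fun _ _ => 0
  Cut := Unit
  cutIn := fun _ _ => True
  cutH := fun _ _ => 0
  cutSup := fun _ => 0

/-- **The flat chain data**: E = F = ℝ; the fields A, A₁, HB and the operators H, D, G̃, W all 0 (the flat stratum); the □-seminorms = |·|;
ℭ_k = {pt} = its near part, far part ∅; observation points {pt}; |B| = 0; |y₂ − y| = 0 (d = 1).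
[cite: Balaban1985Variational, (152)–(161) pp.301–303] -/
@[reducible] def flatX : ChainData flatP (fun _ => ℝ) (fun _ => ℝ) flatGeo 1 where
  fldA := fun _ _ => 0
  fldA₁ := fun _ _ => 0
  fldHB := fun _ _ => 0
  opH := fun _ _ => 0
  opD := fun _ _ => 0
  opGt := fun _ _ => 0
  opW := fun _ _ => 0
  pBox := fun _ _ => normAddGroupSeminorm ℝ
  calC := fun _ => {()}
  nearC := fun _ => {()}
  farC := fun _ => ∅
  boxSites := fun _ => {()}
  absB := fun _ _ _ _ => 0
  rho := fun _ _ => 0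

/-- **The flat first-case data of `B11SectFAssembly`**: the Δ₀-norm functionals and the two (2)-deviations all 0.
[cite: Balaban1985Variational, Sect. F pp.302–304] -/
@[reducible] def flatD : CubeData flatP where
  normA0 := fun _ _ => 0
  normGradA0 := fun _ _ => 0
  normLapA0 := fun _ _ => 0
  plaqDev := fun _ _ => 0
  dstarDev := fun _ _ => 0

/-- **The flat Δ₀ data**: Δ₀-seminorms = |·|, sites of Δ₀ = {pt}. [cite: Balaban1985Variational, (161) p.303 «Δ(y₁) = Δ₀»] -/
@[reducible] def flatY : UnitData flatP (fun _ => ℝ) flatGeo where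
  pUnit := fun _ _ => normAddGroupSeminorm ℝ
  unitSites := fun _ => {()}

/-! ## §2 The hypothesis structures are inhabited at the flat stratum -/

/-- The inner sum of (162) at the one point is 1 (= e⁰·(0 + 1)·(2⁰·1)⁻¹). [cite: Balaban1985Variational, (162) p.303] -/
theorem sum162_flat (C : Finset Unit) (hC : C = {()}) : sum162 flatGeo 0 C () = 1 := by
  subst hC
  simp [sum162, term162, B6.Geometry.len]

/-- The kernel sum of (161)₁ vanishes for B ≡ 0. [cite: Balaban1985Variational, (161) p.303] -/
theorem kernelSum_flat (B₀ : ℝ) (C : Finset Unit) :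
    kernelSum flatGeo 1 0 B₀ C (fun _ _ => (0 : ℝ)) () = 0 := by
  simp [kernelSum]

/-- **`ChainLeaves` at the flat stratum**, for every c₁, a₃, a₄: δ₀ = 0, B₀ = 1/1152, B₁ = 1, B₃ = ½ (= 72·1·2³·B₀·S with S = 1, so (163) is
½ ≦ ½), C₂ = C₄ = 0, R₁M₁ = 1 = M.  Every located display holds with A = A₁ = HB = 0, B = 0 (strict ones by ε₀, ε₁ > 0).
[cite: Balaban1985Variational, Sect. F (144)–(165) pp.300–304] -/
theorem flat_chainLeaves (c₁ a₃ a₄ : ℝ) :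
    ChainLeaves flatP flatX 0 (1 / 1152) 1 (1 / 2) 0 0 1 1 c₁ a₃ a₄ where
  one_le_d := le_rfl
  one_le_L := by norm_num
  eta_pos := by norm_num
  PL_pos := by norm_num
  Peta_pos := by norm_num
  δ₀_nonneg := le_rfl
  B₀_pos := by norm_num
  B₁_pos := by norm_num
  C₂_nonneg := le_rfl
  C₄_nonneg := le_rfl
  one_le_R := le_rfl
  size_ge := fun _ => le_rfl
  pBox_le := fun _ _ x => by simp
  calC_cover := fun _ y => by simp
  near_far_disjoint := fun _ => Finset.disjoint_empty_right _
  calC_nonempty := fun _ => Finset.singleton_nonempty _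
  dist_nonneg := fun _ _ => le_rfl
  absB_nonneg := fun _ _ _ _ => le_rfl
  sep144 := fun _ _ _ y₂ hy₂ => by simp at hy₂
  rho_nonneg := fun _ _ _ => le_rfl
  rho_le := fun _ _ _ _ _ => by norm_num
  sum162_le := fun _ _ _ => (sum162_flat _ rfl).le
  B₃_eq := by norm_num
  ineq163 := by norm_num
  h46 := fun _ x => by rw [norm_zero]; positivity
  hGt := fun _ f => by rw [norm_zero]; positivity
  h55 := fun _ Y _ => by simp
  h98 := fun _ Y _ => by simp
  h152 := fun ε₀ _ _ _ hU _ _ _ => by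
    have hε₀ : (0 : ℝ) < ε₀ := hU
    refine ⟨trivial, ?_, ?_, ?_, ?_⟩
    · rw [norm_zero]; positivity
    all_goals simp
  h157 := fun ε₀ _ _ _ hA _ => by
    refine ⟨by simp, ?_⟩
    have h := hA
    rw [norm_zero] at h
    rw [add_zero, norm_zero]
    linarith
  h158 := fun _ _ _ _ _ _ _ _ _ _ => by simp
  h160 := fun _ ε₁ _ _ _ hε₁ _ _ _ _ _ _ _ _ => by positivity
  h155 := fun _ _ _ _ _ _ _ _ y₂ hy₂ => by simp at hy₂
  h161 := fun _ _ _ _ => ⟨(), by simp, by rw [kernelSum_flat]; simp⟩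

/-- **`UnitLeaves` at the flat stratum** (Δ₀ = □ = the one cube; far part ∅, so the located separation is idle).
[cite: Balaban1985Variational, (161)–(167) pp.303–304 «Δ(y₁) = Δ₀»] -/
theorem flat_unitLeaves (c₁ : ℝ) : UnitLeaves flatP flatX flatD flatY 0 (1 / 1152) c₁ where
  pUnit_le := fun _ _ x => by simp
  unit_sub_box := fun _ => subset_rfl
  sep_unit := fun _ _ _ y₂ hy₂ => by simp at hy₂
  rho_le_unit := fun _ _ _ _ _ => by norm_num
  h152_unit := fun _ _ _ _ _ _ _ _ => by simp
  h161_unit := fun _ _ _ _ => ⟨(), by simp, by rw [kernelSum_flat]; simp⟩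

/-- **The full `B11SectFAssembly.Leaves` record at the flat stratum, THROUGH the chain** (`leaves_of_chain_unit`): both (165)-leaves derived
from `flat_chainLeaves` / `flat_unitLeaves`, the remaining leaves immediate — `dev1142` (deviations 0 < 2e + 8e², e + 36de² + 50de³ for
e > 0), `inU_local` (𝔘_k(r) ∋ U ≡ 1 for r > 0), `holder136` (‖A‖_{1,β} = 0 < B₂·9dL²Mε₀·t^{2+β} with B₂ = 1, ε₀ > 0).  So the typed Sect. F
input of Theorem 1 is exercised end to end on an inhabitant; K = `K165 1 2 (1/1152) 1 0 0 1`.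
[cite: Balaban1985Variational, Sect. F pp.300–305] -/
theorem flat_leaves (c₁ a₃ a₄ : ℝ) :
    Leaves flatP flatD ((1 : ℕ) : ℝ) flatGeo.L 1 1 (1 / 2) (K165 1 flatGeo.L (1 / 1152) 1 0 0 1) 1 c₁ a₃ a₄ := by
  refine leaves_of_chain_unit (flat_chainLeaves c₁ a₃ a₄) (flat_unitLeaves c₁) ?_ ?_ ?_
  · intro U c e _ he _ _ _ _
    constructor
    · show (0 : ℝ) < 2 * e + 8 * e ^ 2
      positivity
    · show (0 : ℝ) < e + 36 * ((1 : ℕ) : ℝ) * e ^ 2 + 50 * ((1 : ℕ) : ℝ) * e ^ 3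
      positivity
  · intro r U hr _
    exact hr
  · intro ε₀ ε₁ V U c _ _ hU _ _ _ β hβ _
    have hε₀ : (0 : ℝ) < ε₀ := hU
    have ht : (0 : ℝ) < tinv flatP c := by
      unfold tinv
      norm_num
    show (0 : ℝ) < 1 * (ε₀ + (9 * ((1 : ℕ) : ℝ) * flatGeo.L ^ 2 * (1 : ℝ) * ε₀ - ε₀)) * tinv flatP c ^ (2 + β)
    have h1 : (0 : ℝ) < ε₀ + (9 * ((1 : ℕ) : ℝ) * flatGeo.L ^ 2 * (1 : ℝ) * ε₀ - ε₀) := by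
      show (0 : ℝ) < ε₀ + (9 * ((1 : ℕ) : ℝ) * (2 : ℝ) ^ 2 * (1 : ℝ) * ε₀ - ε₀)
      norm_num
      linarith
    have h2 : (0 : ℝ) < tinv flatP c ^ (2 + β) := Real.rpow_pos_of_pos ht _
    positivity

end Literature.MathematicalPhysics.QuantumFieldTheory.Balaban1983to89.B11SectFReg165AssemblyWitness
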